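import Summits.QuantumFields.BalabanUV.T4Continuum.Spine.NE1p.DressedTowerWitnessSliceEnd
import Summits.QuantumFields.BalabanUV.T4Continuum.Spine.NE1p.DressedCellNecessity
import Literature.MathematicalPhysics.QuantumFieldTheory.Balaban1983to89.T4FeltGeometry

/-!
# T⁴ programme, spine estimate NE1′ (node O3b/H2) — «A TERMINAL FACE FIRES», part 1: a function-level toy tower at the INTEGER
# blocking factor `L = 21` (`κ = 1∕100`), with the terminal face's DATA — anchoring, housing, booking convention, history-free
# absorption door (formalisation crew `b2b-balaban-t4-ne1p-formalise-*`, leaf seat 03, generation 3, witness item W11 «A TERMINAL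
# FACE FIRES» of typer ruling R-T56 (h), leaf-09-g3's LOCATED OBSERVATION LF-4; own-initiative consistency item, NOT a crew estimate
# row; answer «MINE» CLAIMS.log 2026-08-20T10:51Z)

Cell `pub-balaban`, sub-cell `t4`, BINDER-OWNERS row NE1′ (owner lineage t4-ne1p-p1).  ADDITIVE — imports this seat's row W7 part 2
`Spine/NE1p/DressedTowerWitnessSliceEnd` (p214558: ONLY for the GENERIC two-atom calculus of rows W5∕W7 — `flAt`, `ae_flAt`,
`integrable_flAt`, `aesm_flAt`, `mem_bddClass_flAt`, `wOp_flAt`, `zeroExp`, `realBaseAt_W`, `exponentSliceAt_M`, `base₁`, `ev₀₀`,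
`e₀₀`, `discs_subset_ball`, `norm_t_mul_le` — and leaf-04's `WindowScheduleModWin.geometric`; NOTHING tied to row W5's non-integer
`LW = 6e³` is used) and leaf-07-g2's row S3c `Spine/NE1p/DressedCellNecessity` (p213339: the certified enclosure `exp_three_lt_20_09`)
and the Literature module `T4FeltGeometry` (`Anchoring`, `coarsen`) ONLY; modifies nothing.  Part 2 (`DressedTerminalWitnessEnd`) fires leaf-09-g3's canonical terminal face S3l BY NAME on this datum.

WHY (LF-4, R-T56 (h)).  The four terminal faces S3k∕S3k.1∕S3l∕S3l.1 read L-C off an anchoring with an INTEGER blocking factor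
(`hLb : (Lb : ℝ) = L`, `Anch : Anchoring _ 4 Lb`), while every function-level toy of the crew (W5∕W7∕W7c∕W9∕W10∕W12) runs at row W5's
non-integer cell constant `LW = 2·alphaCell ½ = 6e³`, and the one integer-`L` toy (W8, `L = 21`, `κ = 0`) carries no function-level
data.  So no existing datum can fire a terminal face; the referee's (t5) column for the terminal theorem is covered in two halves
(W7c + W8).  This item builds ONE datum that fires it.

THE DATUM.
* §1 THE CELL AT THE LEAST ADMISSIBLE INTEGER `L = 21` (rows S3c∕W8: 20 blocks are excluded) WITH A POSITIVE RATIO `κ = 1∕100`: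
  located largeness `locCell 21 2 0 (1∕100) = (1 + 4∕100)·e³∕21 ≤ 199∕200 = ρ′ < 1` from `e³ < 20.09` (`hlocT`); (w6) window
  `m·(N₀A₀∕(1−ρ′)) = (1∕400)·200 = ½ ≤ 1 − ½` (equality, `hsmallT`); scalars `(L, C, c̄, κ, N₀, A₀, m, s̄⁰, ρ′, r, c_δ) =
  (21, 2, 0, 1∕100, 1, 1, 1∕400, ½, 199∕200, 1, ½)`.
* §2 ONE CUTOFF-FREE SCHEDULE `W21 := WindowScheduleModWin.geometric 1 1 ψ (ψ∕200) 1 0`, `ψ = 21⁻²`: ratio `2σ_k = ψ^{k+1}∕100 =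
  κ·ϱc_k` EXACTLY (`hratioT`), birth window `bondBall c_T`, slice windows `wc_k = ψ^{k+1}∕100`.
* §3 the function-level datum at every cutoff `K` (rows W5∕W7's pattern at `L = 21`): booking `BT K` (one family born at `0`, one cube
  per scale, booked size `a_K·ψ^{k+1}∕100`), trajectory `TT K`, tower `towerT`; two-atom laws `δ_0 + δ_{z_k}` with `z_k ≡ σ_k`;
  carried functionals `FnT K 0 k U = a_K·(U₀₀ + sh k)` (plain two-point averaging, `FnT_succ` = `hFn` as an EQUATION); births
  `hslT`; the BOOKING CONVENTION replacing F-8: admissible pairs `hneT` and **`hsupT` — `lin ≤ Real.sSup {realised increments}` with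
  the increment set PROVED bounded above by `a_K·δ_k` and attaining it** (so `sSup` is not the junk value; leaf-09-g3's caveat);
  `hDμT`, `hz₁T`; history-free absorption door `habsT` (`Sabs ≡ ∅`, `A = 0`, `β_j = τ^{K−j}`, equality at birth); `hregT`;
  THE ANCHORING `ancT K : Anchoring (BT K) 4 21` at the zero block (W8's pattern), per-block multiplicity `1`, housing
  `compT`∕`ST` (the scale-`k` cube houses the live family for `k ≤ K`), component volume `1`.
DECLARED DEGENERACIES: `𝒜 ≡ 𝒬 ≡ 0`, `Sg ≡ ∅` (observable coupling off), `s ≡ 0`, `ref = id`, `rel = Eq`, one family, no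
regeneration — the live corners are rows W7∕W9∕W10∕W12's (at `LW`); this item is about the INTEGER cell and the terminal DATA.

HONEST FRAMING.  A decided toy ([folklore]; 0 sorry; 0 citations; no `def … : Prop` — the `def`s are DATA); `21` is the toy's
integer, a kernel consequence of `locCell` (never «Bałaban's L», caveat k2); NOTHING of Bałaban's densities, components, blocks or
D-terms is modelled.  Headline (c4): «the canonical terminal face's ENTIRE displayed list — wall families, dictionary, anchoring ∕
housing ∕ booking-convention ∕ absorption DATA, located scalars — is jointly inhabitable by ONE function-level decided datum at an
INTEGER blocking factor, uniformly in the cutoff; non-vacuity of SHAPES; NE1′ ⇐ the named binders, NOT proved»; spine PROVED 0∕9.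
Rung (B)+1 on ONE finite four-torus — NOT infinite volume, NOT a mass gap, NOT OS on ℝ⁴, NOT Clay, NOT summit progress.  HONEST
DEPENDENCY: continuum YM on T⁴ ⇐ BetaPertH ∧ nine spine estimates (0/9 proved); BetaPertH ⇐ (D1) ∧ (D4) ∧ CAP+tail; G-an2-4 gates
asym, D1 and NE2/3/4.
-/

noncomputable section

namespace Summit.QuantumFields.BalabanUV.T4Continuum.NE1p.DressedTerminalWitness

open MeasureTheory Set Metric Filter Finset
open scoped BigOperators
open Literature.MathematicalPhysics.QuantumFieldTheory.Balaban1983to89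
open Literature.MathematicalPhysics.QuantumFieldTheory.Balaban1983to89.T4TermFormat
open Literature.MathematicalPhysics.QuantumFieldTheory.Balaban1983to89.T4TermFormat.Booking
open Literature.MathematicalPhysics.QuantumFieldTheory.Balaban1983to89.T4FeltGeometry
open Literature.MathematicalPhysics.QuantumFieldTheory.Balaban1983to89.T4GatedBooking
open Literature.MathematicalPhysics.QuantumFieldTheory.Balaban1983to89.T4TrajectoryComparison
open T4TrajectoryModulus (bondBall bondBall_add_mem bondBall_latMove_add_mem bondBall_diam)
open T4BlockTransport (Fld NDir latMove latN Site norm_dir_le)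
open T4BirthChartTransport (GaugeInvariant BirthSlice RelGauge)
open T4TrajectoryDensity
open Summit.QuantumFields.BalabanUV.T4Continuum.T4TrajectoryDensityDressed
open Summit.QuantumFields.BalabanUV.T4Continuum.T4TrajectoryDensityWitness
open Summit.QuantumFields.BalabanUV.T4Continuum.NE1p.DressedRoot
open Summit.QuantumFields.BalabanUV.T4Continuum.NE1p.DressedUniformConstants
open Summit.QuantumFields.BalabanUV.T4Continuum.NE1p.DressedWindowScheduleWin
open Summit.QuantumFields.BalabanUV.T4Continuum.NE1p.DressedWindowScheduleModWin
open Summit.QuantumFields.BalabanUV.T4Continuum.NE1p.DressedTowerWitness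
open Summit.QuantumFields.BalabanUV.T4Continuum.NE1p.DressedCellNecessity

/-! ## §1 The cell at the integer blocking factor `21`, `κ = 1∕100` [decided toy] -/

/-- The transport ratio at `L = 21`: `ψ := 21⁻²`. [folklore] -/
abbrev ψT : ℝ := ((21 : ℝ) ^ 2)⁻¹

/-- [arith] [folklore] -/ theorem psiT_pos : 0 < ψT := by unfold ψT; positivity
/-- [arith] [folklore] -/ theorem psiT_lt_one : ψT < 1 := by unfold ψT; norm_num
/-- [arith] [folklore] -/ theorem psiT_le_one : ψT ≤ 1 := psiT_lt_one.le
/-- [arith] [folklore] -/ theorem psiT_pow_le_one (k : ℕ) : ψT ^ k ≤ 1 := pow_le_one₀ psiT_pos.le psiT_le_one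

/-- **THE LOCATED LARGENESS AT THE INTEGER `L = 21` WITH `κ = 1∕100`** [decided numeral]: `alphaCell (1∕100)∕21 + 21·2·0 =
(1 + 4∕100)·e³∕21 ≤ 199∕200` — by the certified enclosure `e³ < 20.09` (row S3c). [folklore] -/
theorem hlocT : locCell 21 (4 * (1 / 2) / 1) 0 (1 / 100) ≤ 199 / 200 := by
  unfold locCell alphaCell
  have h := exp_three_lt_20_09
  have e : Real.exp 3 * (1 + 4 * (1 / 100 : ℝ)) / 21 + 21 * (4 * (1 / 2) / 1) * 0 = Real.exp 3 * (26 / 525) := by ring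
  rw [e]
  linarith

/-- **THE (w6) WINDOW AT THIS CELL, AN EQUALITY** [folklore]: `(1∕400)·(1·1·(1 − 199∕200)⁻¹) = ½ ≤ 1 − ½`. -/
theorem hsmallT : (1 / 400 : ℝ) * (1 * 1 * (1 - 199 / 200)⁻¹) ≤ 1 - 1 / 2 := by norm_num

/-! ## §2 ONE cutoff-free schedule at `L = 21` with ratio `κ = 1∕100` exactly [decided toy] -/

/-- [arith] [folklore] -/ theorem sigma0_pos : 0 < ψT / 200 := by have := psiT_pos; positivity
/-- [arith] [folklore] -/ theorem two_sigma0_le_one : 2 * (ψT / 200) ≤ 1 := by have := psiT_le_one; linarith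

/-- **THE ONE CUTOFF-FREE SCHEDULE** [decided toy]: leaf-04's `WindowScheduleModWin.geometric` with ratio `ψ = 21⁻²`, fluctuation scale
`σ₀ = ψ∕200`, radius scale `ϱ₀ = 1 = r`, final window `0`, slice window `w = 1`. [folklore] -/
def W21 : WindowScheduleModWin 1 1 :=
  WindowScheduleModWin.geometric 1 1 ψT (ψT / 200) 1 0 psiT_pos psiT_lt_one sigma0_pos two_sigma0_le_one one_pos le_rfl

/-- The birth-window radius `c_T = ((1 + 2ψ)·ψ∕200 + 1)∕(1 − ψ)` (cutoff-free). [folklore] -/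
def cT21 : ℝ := ((1 + 2 * ψT) * (ψT / 200) + 1) / (1 - ψT)

/-- [arith] [folklore] -/
theorem cT21_pos : 0 < cT21 := by
  have h1 := psiT_pos; have h2 := psiT_lt_one
  unfold cT21; exact div_pos (by positivity) (by linarith)

/-- [arith] [folklore] The schedule's fields, unfolded. -/
theorem W21_ρw (k : ℕ) : W21.ρw k = cT21 * ψT ^ k := by
  show 0 + ((1 + 2 * ψT) * (ψT / 200) + 1) / (1 - ψT) * ψT ^ k = _
  rw [zero_add]; rfl

/-- [arith] [folklore] -/ theorem W21_σ (k : ℕ) : W21.σ k = ψT / 200 * ψT ^ k := rfl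
/-- [arith] [folklore] -/ theorem W21_ϱc (k : ℕ) : W21.ϱc k = 1 * ψT ^ (k + 1) := rfl
/-- [arith] [folklore] -/ theorem W21_wc (k : ℕ) : W21.wc k = 2 * (ψT / 200) * ψT ^ k := rfl

/-- [arith] [folklore] The birth window is `bondBall c_T`. -/
theorem W21_ρw_zero : W21.ρw 0 = cT21 := by rw [W21_ρw, pow_zero, mul_one]

/-- [folklore] The zero background lies in every window. -/
theorem zero_mem_windowT (k : ℕ) : (0 : Fld 4 ℂ) ∈ (bondBall 4 (W21.ρw k) : Set (Fld 4 ℂ)) :=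
  WindowScheduleModWin.geometric_zero_mem_window (r := 1) psiT_pos psiT_lt_one sigma0_pos two_sigma0_le_one one_pos le_rfl
    le_rfl k

/-- **THE SCHEDULE's K-FREE RATIO, EXACTLY `κ = 1∕100`**: `2σ_k = ψ^{k+1}∕100 = (1∕100)·ϱc_k`. [folklore] -/
theorem hratioT : ∀ k, 2 * W21.σ k ≤ 1 / 100 * W21.ϱc k := fun k => by
  rw [W21_σ, W21_ϱc, pow_succ]; exact le_of_eq (by ring)

/-! ## §3 The function-level datum at cutoff `K` [decided toy] -/

/-- The atom size ∕ fluctuation scale of step `k`: `α_k := ψ^{k+1}∕200 = σ_k`. [folklore] -/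
def αT (k : ℕ) : ℝ := ψT ^ (k + 1) / 200

/-- The transverse defect of step `k`: `δ_k := ψ^{k+1}∕100 = wc_k`. [folklore] -/
def dT (k : ℕ) : ℝ := ψT ^ (k + 1) / 100

/-- [arith] [folklore] -/ theorem αT_pos (k : ℕ) : 0 < αT k := by unfold αT; have := psiT_pos; positivity
/-- [arith] [folklore] -/ theorem dT_pos (k : ℕ) : 0 < dT k := by unfold dT; have := psiT_pos; positivity

/-- The second atom of step `k`: the constant bond field `α_k`. [folklore] -/
def atomT (k : ℕ) : Fld 4 ℂ := fun _ _ => ((αT k : ℝ) : ℂ)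

/-- [folklore] -/ @[simp] theorem ev₀₀_atomT (k : ℕ) : ev₀₀ (atomT k) = ((αT k : ℝ) : ℂ) := rfl

/-- The birth amplitude at cutoff `K`: `a_K = τ^K∕(2(c_T + 3))`, `τ = 21⁻³`. [folklore] -/
def aT (K : ℕ) : ℝ := ((21 : ℝ)⁻¹ ^ 3) ^ K / (2 * (cT21 + 3))

/-- [arith] [folklore] -/ theorem aT_pos (K : ℕ) : 0 < aT K := by unfold aT; have := cT21_pos; positivity

/-- TOY BOOKING at cutoff `K` [decided toy]: one family born at scale `0`, one cube per scale, felt everywhere, booked size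
`a_K·δ_k`.  Nothing of Bałaban's is modelled. [folklore] -/
def BT (K : ℕ) : T4TermFormat.Booking where
  K := K
  Dom := Unit
  domScale := fun _ => 0
  treeLen := fun _ => 0
  treeLen_nonneg := fun _ => le_rfl
  balSize := fun _ => 0
  Birth := Unit
  births := {()}
  mem_births := fun b => by simp
  birthScale := fun _ => 0
  birth_le := fun _ => Nat.zero_le K
  loc := fun _ => ()
  loc_scale := fun _ => rfl
  Cube := Fin (K + 1)
  cubes := Finset.univ
  mem_cubes := fun q => Finset.mem_univ q
  cubeScale := fun q => q.val
  cube_le := fun q => Nat.lt_succ_iff.mp q.isLt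
  feltAt := fun _ => {()}
  felt_birth_le := fun _ _ _ => Nat.zero_le _
  size := fun _ k => aT K * dT k
  size_nonneg := fun _ k => (mul_pos (aT_pos K) (dT_pos k)).le
  pair := fun _ _ _ => 0

/-- TOY TRAJECTORY at cutoff `K` [decided toy]: one generation (size `a_K·(c_T + 3)`), `lin b 0 k = a_K·δ_k`. [folklore] -/
def TT (K : ℕ) : Trajectory (BT K) where
  lin := fun _ k' k => if k' = 0 then aT K * dT k else 0
  lin_nonneg := fun _ k' k => by
    split_ifs
    · exact (mul_pos (aT_pos K) (dT_pos k)).le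
    · exact le_rfl
  gen := fun _ k' => if k' = 0 then aT K * (cT21 + 3) else 0
  gen_nonneg := fun _ k' => by
    split_ifs
    · exact (mul_pos (aT_pos K) (by linarith [cT21_pos])).le
    · exact le_rfl
  size_le := fun b k _ _ => by
    show aT K * dT k ≤ ∑ k' ∈ Icc 0 k, (if k' = 0 then aT K * dT k else 0)
    rw [Finset.sum_ite_eq' (Icc 0 k) 0 (fun _ => aT K * dT k)]
    simp

/-- TOY TOWER at the integer cell [decided toy]: the datum at every cutoff (one run parameter). [folklore] -/
def towerT : DressedTower Unit where
  B := fun _ K => BT K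
  K_eq := fun _ _ => rfl
  T := fun _ K => TT K

/-- The accumulated dressing: `sh 0 = 0`, `sh (k+1) = sh k + α_k∕2`. [folklore] -/
def shT : ℕ → ℂ
  | 0 => 0
  | k + 1 => shT k + (((αT k / 2 : ℝ)) : ℂ)

/-- THE CARRIED FUNCTIONALS at cutoff `K` [decided toy]: generation `0` at scale `k` is `a_K·(U₀₀ + sh k)`; later generations `0`. [folklore] -/
def FnT (K : ℕ) (k' k : ℕ) (U : Fld 4 ℂ) : ℂ := if k' = 0 then (aT K : ℂ) * (ev₀₀ U + shT k) else 0

/-- `hFn` AS AN EQUATION: the step is the plain two-point average on `δ_0 + δ_{z_k}` (row W5's `wOp_flAt`). [folklore] -/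
theorem FnT_succ (K k' k : ℕ) (U : Fld 4 ℂ) :
    FnT K k' (k + 1) U = wOp (expWeight base₁ (zeroExp + zeroExp)) (flAt (atomT k)) 0 U (fun z => FnT K k' k (U + z)) := by
  rw [wOp_flAt]
  by_cases h : k' = 0
  · subst h
    simp only [FnT, ↓reduceIte, shT, ev₀₀_add, ev₀₀_atomT, add_zero]
    push_cast; ring
  · simp [FnT, h]

/-- The gauge direction of step `k`: `δ_k·e₀₀` with declared bound `δ_k`. [folklore] -/
def dirT (k : ℕ) : NDir 4 ℂ := fldDir (((dT k : ℝ) : ℂ) • e₀₀) (dT k) fun x ν => by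
  rw [Pi.smul_apply, Pi.smul_apply, norm_smul, Complex.norm_real, Real.norm_eq_abs, abs_of_pos (dT_pos k)]
  calc dT k * ‖e₀₀ x ν‖ ≤ dT k * 1 := mul_le_mul_of_nonneg_left (norm_e₀₀_le x ν) (dT_pos k).le
    _ = dT k := mul_one _

/-- [folklore] Moving `0` by `1` along `dirT k` lands at `U₀₀ = δ_k`. -/
theorem ev₀₀_move_dirT (k : ℕ) : ev₀₀ (latMove 0 (dirT k) 1) = ((dT k : ℝ) : ℂ) := by
  rw [ev₀₀_latMove]
  show ev₀₀ 0 + 1 * ev₀₀ (((dT k : ℝ) : ℂ) • e₀₀) = _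
  rw [ev₀₀_smul, ev₀₀_e₀₀, ev₀₀_zero]; ring

/-! ## §4 The END binders on the datum [folklore] -/

/-- `hsl` (w1) at the full slice window `1`: births on `bondBall c_T`, bound `a_K·(c_T + 3)`; later generations `0`. [folklore] -/
theorem hslT (K : ℕ) (b : (BT K).Birth) (k' : ℕ) :
    BirthSlice (FnT K k' k') latMove latN (bondBall 4 (W21.ρw k') : Set (Fld 4 ℂ)) 1 1 ((TT K).gen b k') := by
  intro U hU p hp hp1
  by_cases hk : k' = 0
  · subst hk
    have hUc : ‖ev₀₀ U‖ ≤ cT21 := by rw [← W21_ρw_zero]; exact hU 0 0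
    refine ⟨ball 0 (3 / latN p), ?_, fun t ht => ?_, discs_subset_ball hp hp1 (by norm_num)⟩
    · simp only [FnT, ↓reduceIte, ev₀₀_latMove]; fun_prop
    · show ‖FnT K 0 0 (latMove U p t)‖ ≤ (if (0 : ℕ) = 0 then aT K * (cT21 + 3) else 0)
      simp only [FnT, ↓reduceIte, ev₀₀_latMove, shT, add_zero]
      have h3 := norm_t_mul_le p hp ht
      rw [norm_mul, Complex.norm_real, Real.norm_eq_abs, abs_of_pos (aT_pos K)]
      calc aT K * ‖ev₀₀ U + t * ev₀₀ p.1.1‖ ≤ aT K * (‖ev₀₀ U‖ + ‖t * ev₀₀ p.1.1‖) :=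
            mul_le_mul_of_nonneg_left (norm_add_le _ _) (aT_pos K).le
        _ ≤ aT K * (cT21 + 3) := mul_le_mul_of_nonneg_left (by linarith) (aT_pos K).le
  · refine ⟨univ, ?_, fun t _ => ?_, fun _ _ => subset_univ _⟩
    · simp only [FnT, if_neg hk]; fun_prop
    · show ‖FnT K k' k' (latMove U p t)‖ ≤ (if k' = 0 then aT K * (cT21 + 3) else 0)
      simp [FnT, hk]

/-- `hDμ`: both atoms of step `k` lie in `bondBall (σ_k)` (`z_k ≡ σ_k`). [folklore] -/
theorem hDμT (k : ℕ) : ∀ᵐ z ∂flAt (atomT k), z ∈ (bondBall 4 (W21.σ k) : Set (Fld 4 ℂ)) := by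
  refine ae_flAt.mpr ⟨fun x ν => ?_, fun x ν => ?_⟩
  · rw [W21_σ, Pi.zero_apply, Pi.zero_apply, norm_zero]; have := psiT_pos; positivity
  · rw [W21_σ]
    simp only [atomT, Complex.norm_real, Real.norm_eq_abs, αT]
    rw [abs_of_nonneg (by have := psiT_pos; positivity), pow_succ]
    exact le_of_eq (by ring)

/-- `hz₁`: the reference fluctuation `0` lies in every fluctuation domain. [folklore] -/
theorem hz₁T (k : ℕ) : (0 : Fld 4 ℂ) ∈ (bondBall 4 (W21.σ k) : Set (Fld 4 ℂ)) := fun x ν => by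
  rw [W21_σ, Pi.zero_apply, Pi.zero_apply, norm_zero]; have := psiT_pos; positivity

/-- `hdefwk`: the defect `δ_k` IS the step's slice window `wc_k`. [folklore] -/
theorem hdefwkT (k : ℕ) : dT k ≤ W21.wc k := by
  rw [W21_wc]; unfold dT; rw [pow_succ]; exact le_of_eq (by ring)

/-- `hrate` (I4′): the defect decays at the transport rate, `δ_k ≤ ½·ψ^{k−k′}`. [folklore] -/
theorem hrateT (k' k : ℕ) : dT k ≤ 1 / 2 * ψT ^ (k - k') := by
  have h1 : ψT ^ (k + 1) ≤ ψT ^ (k - k') := pow_le_pow_of_le_one psiT_pos.le psiT_le_one (by omega)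
  calc dT k = ψT ^ (k + 1) * (1 / 100) := by unfold dT; ring
    _ ≤ ψT ^ (k - k') * (1 / 2) := mul_le_mul h1 (by norm_num) (by norm_num) (pow_nonneg psiT_pos.le _)
    _ = 1 / 2 * ψT ^ (k - k') := by ring

/-- (w4) `hdom` on this schedule, discharged by `hratioT` through row S3's `hdom_cell`. [folklore] -/
theorem hdomT (K k : ℕ) (_hk : k + 1 ≤ (BT K).K) :
    Real.exp 3 * (1 + 4 * (2 * W21.σ k) / W21.ϱc k) ≤ (fun _ : ℕ => alphaCell (1 / 100)) k :=
  hdom_cell (W21.hϱc k) (hratioT k)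

/-- **THE BOOKING CONVENTION, I — admissible pairs exist** (`hne`): base `0 ∈ 𝒦`, gauge image along `dirT k`. [folklore] -/
theorem hneT (k : ℕ) :
    ∃ U₀ ∈ (bondBall 4 (W21.ρw k) : Set (Fld 4 ℂ)), ∃ U₁ : Fld 4 ℂ,
      RelGauge (fun U U' : Fld 4 ℂ => U = U') latMove latN U₀ U₁ (dT k) :=
  ⟨0, zero_mem_windowT k, latMove 0 (dirT k) 1, ⟨dirT k, dT_pos k, le_rfl, rfl⟩⟩

/-- [folklore] Every realised increment of generation `0` is at most `a_K·δ_k` (the direction's window norm bounds `|d₀₀|`). -/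
theorem increment_le (K k : ℕ) {U₀ U₁ : Fld 4 ℂ}
    (h : RelGauge (fun U U' : Fld 4 ℂ => U = U') latMove latN U₀ U₁ (dT k)) :
    ‖FnT K 0 k U₁ - FnT K 0 k U₀‖ ≤ aT K * dT k := by
  obtain ⟨d, _, hdδ, hrel⟩ := h
  have e : FnT K 0 k U₁ - FnT K 0 k U₀ = (aT K : ℂ) * (1 * ev₀₀ d.1.1) := by
    rw [hrel]; simp only [FnT, ↓reduceIte, ev₀₀_latMove]; ring
  rw [e, norm_mul, Complex.norm_real, Real.norm_eq_abs, abs_of_pos (aT_pos K), one_mul]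
  exact mul_le_mul_of_nonneg_left ((norm_dir_le d 0 0).trans hdδ) (aT_pos K).le

/-- **THE BOOKING CONVENTION, II — booked size ≤ sup of realised increments** (`hsup`), with the increment set PROVED bounded above
(by `a_K·δ_k`, `increment_le`) and attaining `a_K·δ_k` (along `dirT k`) — so `Real.sSup` is a genuine supremum, not its junk value;
for the absent later generations `lin = 0 ≤ sSup` of a set of norms. [folklore] -/
theorem hsupT (K : ℕ) (b : (BT K).Birth) (k' k : ℕ) :
    (TT K).lin b k' k ≤ sSup {x : ℝ | ∃ U₀ ∈ (bondBall 4 (W21.ρw k) : Set (Fld 4 ℂ)), ∃ U₁ : Fld 4 ℂ,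
      RelGauge (fun U U' : Fld 4 ℂ => U = U') latMove latN U₀ U₁ (dT k) ∧ x = ‖FnT K k' k U₁ - FnT K k' k U₀‖} := by
  show (if k' = 0 then aT K * dT k else 0) ≤ _
  by_cases hk : k' = 0
  · subst hk
    rw [if_pos rfl]
    refine le_csSup ⟨aT K * dT k, ?_⟩ ⟨0, zero_mem_windowT k, latMove 0 (dirT k) 1, ⟨dirT k, dT_pos k, le_rfl, rfl⟩, ?_⟩
    · rintro x ⟨U₀, _, U₁, hRG, rfl⟩
      exact increment_le K k hRG
    · simp only [FnT, ↓reduceIte, ev₀₀_move_dirT, ev₀₀_zero, zero_add]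
      rw [show (aT K : ℂ) * (((dT k : ℝ) : ℂ) + shT k) - (aT K : ℂ) * shT k = ((aT K * dT k : ℝ) : ℂ) by push_cast; ring,
        Complex.norm_real, Real.norm_eq_abs, abs_of_pos (mul_pos (aT_pos K) (dT_pos k))]
  · rw [if_neg hk]
    exact Real.sSup_nonneg fun x ⟨_, _, _, _, hx⟩ => hx ▸ norm_nonneg _

/-- The birth bounds `β_j := τ^{K−j}` of the history-free absorption door (`Sabs ≡ ∅`, `A = 0`). [folklore] -/
def βT (K : ℕ) (j : ℕ) : ℝ := 1 * ((21 : ℝ)⁻¹ ^ 3) ^ (K - j)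

/-- (w1)+(w5b) `habs` — THE HISTORY-FREE DOOR, for ANY gate: `C·gen b 0 = 2·a_K·(c_T + 3) = τ^K = β_0 + 0·Σ_∅` EXACTLY. [folklore] -/
theorem habsT (K : ℕ) (Gate : ℕ → Prop) :
    (TT K).AbsorbsFrom (4 * (1 / 2) / 1) (fun _ : ℕ => ψT * alphaCell (1 / 100)) (βT K) 0
      (fun _ => (∅ : Finset (BT K).Birth)) Gate := fun b _ _ => by
  show 4 * (1 / 2) / 1 * (if (0 : ℕ) = 0 then aT K * (cT21 + 3) else 0) ≤ βT K 0 + 0 * _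
  have hc : 0 < cT21 + 3 := by linarith [cT21_pos]
  simp only [↓reduceIte, βT, Nat.sub_zero, one_mul, zero_mul, add_zero]
  unfold aT
  rw [show 4 * (1 / 2 : ℝ) / 1 * (((21 : ℝ)⁻¹ ^ 3) ^ K / (2 * (cT21 + 3)) * (cT21 + 3)) = ((21 : ℝ)⁻¹ ^ 3) ^ K by
    field_simp; ring]

/-- (w5) `hreg`: no regeneration (later generations are `0`), for ANY gate. [folklore] -/
theorem hregT (K : ℕ) (Gate : ℕ → Prop) : (TT K).RegeneratesFromVar (fun _ : ℕ => (0 : ℝ)) Gate :=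
  fun b k _ _ _ => by
    show (if k + 1 = 0 then aT K * (cT21 + 3) else 0) ≤ 0 * ((BT K).size b k)
    simp

/-! ## §5 The terminal face's DATA: anchoring, housing, component volume [decided toy] -/

/-- **THE ANCHORING ON `ℕ⁴` WITH BLOCKING INTEGER `21`** [decided toy]: every localisation domain is the zero block, every cube is
centred at the zero block (row W8's pattern). [folklore] -/
def ancT (K : ℕ) : Anchoring (BT K) 4 21 where
  dom := fun _ => {0}
  center := fun _ => 0
  felt_under := fun _ _ _ => ⟨0, Finset.mem_singleton_self _, by funext i; simp [coarsen]⟩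

/-- Per-block multiplicity `mB = 1`: one family. [folklore] -/
theorem hmultT (K : ℕ) : ∀ j (x : Fin 4 → ℕ),
    ((BT K).births.filter fun b => (BT K).birthScale b = j ∧ x ∈ (ancT K).dom b).card ≤ 1 := by
  intro j x
  exact (Finset.card_filter_le _ _).trans (Finset.card_singleton ()).le

/-- Met components [decided toy]: the one cube of the current scale (none above the cutoff). [folklore] -/
def compT (K : ℕ) (k : ℕ) (_b : (BT K).Birth) : Finset (Fin (K + 1)) :=
  if h : k ≤ K then {⟨k, Nat.lt_succ_of_le h⟩} else ∅

/-- The component's cubes have the current scale. [folklore] -/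
theorem hscaleT (K : ℕ) : ∀ k b, ∀ q ∈ compT K k b, (BT K).cubeScale q = k := by
  intro k b q hq
  unfold compT at hq
  split_ifs at hq with h
  · rw [Finset.mem_singleton] at hq
    subst hq
    rfl
  · simp at hq

/-- Component volume `v = 1`. [folklore] -/
theorem hvolT (K : ℕ) : ∀ k b, (compT K k b).card ≤ 1 := by
  intro k b; unfold compT; split_ifs <;> simp

/-- Live families of a met component [decided toy]: the family itself at scales `≤ K`, none above the cutoff. [folklore] -/
def ST (K : ℕ) (k : ℕ) (b : (BT K).Birth) : Finset (BT K).Birth := if k ≤ K then {b} else ∅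

/-- Live families are housed: felt at the component's cube. [folklore] -/
theorem hhousedT (K : ℕ) : ∀ k b, ∀ f ∈ ST K k b, ∃ q ∈ compT K k b, f ∈ (BT K).feltAt q := by
  intro k b f hf
  unfold ST at hf
  split_ifs at hf with hkK
  · refine ⟨⟨k, Nat.lt_succ_of_le hkK⟩, ?_, Finset.mem_singleton.mpr rfl⟩
    unfold compT
    rw [dif_pos hkK]
    exact Finset.mem_singleton_self _
  · simp at hf

end Summit.QuantumFields.BalabanUV.T4Continuum.NE1p.DressedTerminalWitness

end
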